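import Literature.MathematicalPhysics.QuantumFieldTheory.VillainCoboundaryMatrix
import Literature.MathematicalPhysics.QuantumFieldTheory.U1CoulombEnergy
import HarnessLib

/-!
# The spin-wave energy of the sheet of a Wilson loop in the Villain theory on a cube is bounded
# by the perimeter: `E_Λ(S_γ) ≤ C (R + T)`

Support file for the duality transformation of four-dimensional `U(1)` lattice gauge theory with
the Villain action (proof programme of the named fact
`Literature.MathematicalPhysics.QuantumFieldTheory.FrohlichSpencerU1PerimeterLawD4` and of its
corollary `Literature.Barriers.QuantumFields.AbelianDeconfinementD4`). In the duality formula
(`VillainDuality.zdVillainExpect_wilsonLoop_eq_dual`) the Gaussian (spin-wave) factor of the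
Wilson loop is `exp(-E_n(S)/(2β))` with `E_n(S) = exactEnergy dMat S`, the energy of the exact part
of the sheet (FS82 (2.52)–(2.54): `e^{-(1/2β)(ε_Λ, ε_Λ)}`). Fröhlich–Spencer assert after (2.88)
that `(ε_Λ, ε_Λ) ≤ const (L + T)`; the tree's `U1CoulombSheetEnergy.exists_closedChain_sheet`
supplies, in every dimension `d ≥ 4`, a closed finitely supported competitor `c` with
`‖S_γ + c‖² ≤ C (R + T)`. Since `LatticeAxialGauge` (and hence `dMat`) lives on the cubes
`halfOpenBox d N = [0, N)^d`, whereas centred cubes `box d m = {-m,…,m}^d` are the natural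
exhaustion, we translate: `box d m + m·𝟙 = halfOpenBox d (2m+1)` (`image_add_diag_box`), tensors
translate by `transl a M = M(· - a)` (finite support, alternation, closedness and the pairing
`pair₂` are invariant; `sheetT_add` : the sheet of the translated loop is the translated sheet),
and we obtain (`exactEnergy_sheet_le`): **there is `C > 0` such that for every rectangle
(`x₀`, plane `i < j`, sides `R, T ≥ 1`) and all large `m`, the spin-wave energy of the sheet of the
translated loop at `x₀ + m·𝟙` in the cube `halfOpenBox d (2m+1)` is `≤ C (R + T)`** — by the
variational bound `VillainCoboundaryMatrix.exactEnergy_dMat_le_of_closed` with the translated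
competitor. Everything is proved; no named fact is introduced.

## References

* J. Fröhlich, T. Spencer, Comm. Math. Phys. 83 (1982) 411–454, §2.7 (2.50)–(2.54), §2.10 (2.88)
  and the sentence following it. [FrohlichSpencerCMP1982]
-/

noncomputable section

open Finset Function Filter Matrix
open Literature.Probability.LatticeModels
open Literature.Probability.LatticeModels.GaussianCoord (exactEnergy)

namespace Literature.MathematicalPhysics.QuantumFieldTheory

/-- Sites of `ℤ^d` (the namespace-local `Site` is the torus one). -/
local notation "ZSite" => Literature.Probability.LatticeModels.Site

namespace VillainAngle

open LatticeForm LatticeChain AxialGauge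

variable {d : ℕ}

/-! ### Translation of tensors -/

/-- Translation of a 2-tensor by `a`: `(τ_a M)(y) = M(y - a)`. [folklore] -/
def transl (a : ZSite d) (M : ZSite d → Fin d → Fin d → ℝ) : ZSite d → Fin d → Fin d → ℝ :=
  fun y => M (y - a)

/-- Translates of finitely supported tensors are finitely supported. [folklore] -/
theorem hasFiniteSupport_transl (a : ZSite d) {M : ZSite d → Fin d → Fin d → ℝ} (hM : HasFiniteSupport M) :
    HasFiniteSupport (transl a M) :=
  hasFiniteSupport_comp_sub hM a

/-- Translates of alternating tensors are alternating. [folklore] -/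
theorem isAltR₂_transl (a : ZSite d) {M : ZSite d → Fin d → Fin d → ℝ} (hM : IsAltR₂ M) :
    IsAltR₂ (transl a M) := fun y k l => hM (y - a) k l

/-- `div₂` commutes with translations. [folklore] -/
theorem div₂_transl (a : ZSite d) (M : ZSite d → Fin d → Fin d → ℝ) (y : ZSite d) (k : Fin d) :
    div₂ (transl a M) y k = div₂ M (y - a) k := by
  simp only [div₂, transl]
  refine Finset.sum_congr rfl fun j _ => ?_
  rw [sub_right_comm]

/-- Translates of closed 2-chains are closed. [folklore] -/
theorem div₂_transl_eq_zero (a : ZSite d) {M : ZSite d → Fin d → Fin d → ℝ} (hM : div₂ M = 0) :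
    div₂ (transl a M) = 0 := by
  funext y k
  rw [div₂_transl, hM]
  rfl

/-- The pairing is translation invariant. [folklore] -/
theorem pair₂_transl (a : ZSite d) (M N : ZSite d → Fin d → Fin d → ℝ) :
    pair₂ (transl a M) (transl a N) = pair₂ M N := by
  unfold pair₂ transl
  congr 1
  exact (Equiv.subRight a).tsum_eq fun y => ∑ k, ∑ l, M y k l * N y k l

/-- `transl` is additive. [folklore] -/
theorem transl_add (a : ZSite d) (M N : ZSite d → Fin d → Fin d → ℝ) :
    transl a (M + N) = transl a M + transl a N := rfl

/-- **The sheet of the translated loop is the translated sheet.** [folklore] -/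
theorem sheetT_add (x₀ a : ZSite d) (i j : Fin d) (R T : ℕ) :
    sheetT (x₀ + a) i j R T = transl a (sheetT x₀ i j R T) := by
  funext y k l
  simp only [sheetT, transl, rectInd]
  congr 1
  refine Finset.sum_congr rfl fun s _ => ?_
  rw [segInd_sub, add_right_comm]

/-- The plaquettes of the translated rectangle are the translated plaquettes. [folklore] -/
theorem rectPlaqs_add (x₀ a : ZSite d) (i j : Fin d) (R T : ℕ) :
    rectPlaqs (x₀ + a) i j R T = (rectPlaqs x₀ i j R T).image (Plaq.shift a) := by
  rw [rectPlaqs, rectPlaqs, Finset.image_image]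
  refine Finset.image_congr fun ts _ => ?_
  simp only [Function.comp_apply, Plaq.shift]
  refine Prod.ext ?_ rfl
  simp only
  abel

/-! ### Centred cubes and the cubes of `LatticeAxialGauge` -/

/-- The diagonal vector `m·𝟙`. [folklore] -/
def diag (d m : ℕ) : ZSite d := fun _ => (m : ℤ)

/-- `box d m + m·𝟙 = halfOpenBox d (2m+1)`. [folklore] -/
theorem image_add_diag_box (m : ℕ) :
    (box d m).image (· + diag d m) = halfOpenBox d (2 * m + 1) := by
  ext y
  rw [Finset.mem_image, mem_halfOpenBox]
  constructor
  · rintro ⟨x, hx, rfl⟩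
    rw [mem_box] at hx
    intro i
    have := hx i
    simp only [Pi.add_apply, diag]
    push_cast
    omega
  · intro hy
    refine ⟨y - diag d m, ?_, sub_add_cancel _ _⟩
    rw [mem_box]
    intro i
    have := hy i
    simp only [Pi.sub_apply, diag]
    push_cast at this
    omega

/-- The plaquettes of `halfOpenBox d (2m+1)` are the translates of those of `box d m`. [folklore] -/
theorem plaquettesIn_halfOpenBox_eq_image (m : ℕ) :
    plaquettesIn (halfOpenBox d (2 * m + 1)) = (plaquettesIn (box d m)).image (Plaq.shift (diag d m)) := by
  rw [← image_add_diag_box, Plaq.plaquettesIn_image_add]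

/-- Membership transport: `(y; k, l)` is a plaquette of `box d m` iff `(y + m·𝟙; k, l)` is one of
`halfOpenBox d (2m+1)`. [folklore] -/
theorem shift_mem_plaquettesIn_halfOpenBox_iff {m : ℕ} {p : Plaq d} :
    Plaq.shift (diag d m) p ∈ plaquettesIn (halfOpenBox d (2 * m + 1)) ↔ p ∈ plaquettesIn (box d m) := by
  rw [plaquettesIn_halfOpenBox_eq_image, Finset.mem_image]
  constructor
  · rintro ⟨q, hq, hqp⟩
    rwa [← Plaq.shift_injective _ hqp]
  · exact fun h => ⟨p, h, rfl⟩

/-! ### The spin-wave energy of the sheet -/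

/-- **The spin-wave energy of the sheet is bounded by the perimeter** (`d = n + 1 ≥ 4`): there is
`C > 0` such that for every base point `x₀`, plane `i < j` and sides `R, T ≥ 1`, for all large `m`,
with `N = 2m + 1`, `Λ = halfOpenBox d N = box d m + m·𝟙` and the translated loop at `x₀ + m·𝟙`,
`E_T(S) = exactEnergy dMat S ≤ C (R + T)` for the sheet `S` of the loop in `Λ`
(FS82: `(ε_Λ, ε_Λ) ≤ const (L + T)`, via the closed competitor of `U1CoulombSheetEnergy`).
[cite: FrohlichSpencerCMP1982, §2.10 (2.88) and the sentence following it] -/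
theorem exactEnergy_sheet_le {n : ℕ} (hn : 3 ≤ n) :
    ∃ C : ℝ, 0 < C ∧ ∀ (x₀ : ZSite (n + 1)) (i j : Fin (n + 1)), i < j → ∀ R T : ℕ, 1 ≤ R → 1 ≤ T →
      ∀ᶠ m : ℕ in atTop,
        exactEnergy (dMat (d := n + 1) (n := 2 * m + 1))
            (fun p => (sheet (halfOpenBox (n + 1) (2 * m + 1)) (x₀ + diag (n + 1) m) i j R T p : ℝ)) ≤
          C * (R + T) := by
  obtain ⟨C, hC, h⟩ := exists_closedChain_sheet hn
  refine ⟨C, hC, fun x₀ i j hij R T hR hT => ?_⟩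
  obtain ⟨c, hfs, halt, hcl, hle⟩ := h x₀ i j hij.ne R T hR hT
  filter_upwards [eventually_rectPlaqs_subset (x₀ := x₀) hij R T,
    eventually_support_subset hfs halt] with m hsub hsupp
  set a : ZSite (n + 1) := diag (n + 1) m with ha
  set Λ := halfOpenBox (n + 1) (2 * m + 1) with hΛ
  -- the translated loop's plaquettes lie in `Λ`
  have hsub' : rectPlaqs (x₀ + a) i j R T ⊆ plaquettesIn Λ := by
    rw [rectPlaqs_add, hΛ, ha, plaquettesIn_halfOpenBox_eq_image]
    exact Finset.image_subset_image hsub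
  -- the translated competitor `-τ_a c`, supported on the plaquettes of `Λ`, closed, alternating
  set c' : ZSite (n + 1) → Fin (n + 1) → Fin (n + 1) → ℝ := transl a (-c) with hc'
  have halt' : ∀ y k l, c' y l k = -c' y k l := fun y k l => by
    simp only [hc', transl, Pi.neg_apply, halt (y - a) k l, neg_neg]
  have hsupp' : ∀ y k l, c' y k l ≠ 0 → (y, k, l) ∈ plaquettesIn Λ ∨ (y, l, k) ∈ plaquettesIn Λ := by
    intro y k l hne
    have hne' : c (y - a) k l ≠ 0 := by simpa [hc', transl] using hne
    have hy : y = (y - a) + a := (sub_add_cancel y a).symm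
    rcases hsupp (y - a) k l hne' with h1 | h1
    · left
      rw [hy]
      exact (shift_mem_plaquettesIn_halfOpenBox_iff (p := ((y - a), k, l))).2 h1
    · right
      rw [hy]
      exact (shift_mem_plaquettesIn_halfOpenBox_iff (p := ((y - a), l, k))).2 h1
  set cP : ↥(plaquettesIn Λ) → ℝ := ofChain Λ c' with hcP
  have hchain : fluxChain Λ cP = c' := fluxChain_ofChain halt' hsupp'
  have hclosed : div₂ (fluxChain Λ cP) = 0 := by
    rw [hchain, hc']
    refine div₂_transl_eq_zero a ?_
    rw [div₂_neg, hcl, neg_zero]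
  -- the sheet of the translated loop
  set S : ↥(plaquettesIn Λ) → ℝ := fun p => (sheet Λ (x₀ + a) i j R T p : ℝ) with hS
  have hsheet : fluxChain Λ S = transl a (sheetT x₀ i j R T) := by
    rw [hS, fluxChain_sheet hij hsub', sheetT_add]
  -- the variational bound with the translated competitor
  calc exactEnergy dMat S ≤ ∑ p, (S p - cP p) ^ 2 := exactEnergy_dMat_le_of_closed S cP hclosed
    _ = pair₂ (fluxChain Λ (S - cP)) (fluxChain Λ (S - cP)) := by
        rw [← sum_sq_eq_pair₂_fluxChain]; rfl
    _ = pair₂ (sheetT x₀ i j R T + c) (sheetT x₀ i j R T + c) := by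
        rw [fluxChain_sub, hchain, hsheet, hc']
        have : transl a (sheetT x₀ i j R T) - transl a (-c) = transl a (sheetT x₀ i j R T + c) := by
          funext y k l; simp [transl]
        rw [this, pair₂_transl]
    _ ≤ C * (R + T) := hle

end VillainAngle

end Literature.MathematicalPhysics.QuantumFieldTheory
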